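import Summits.QuantumFields.BalabanUV.T4Continuum.Spine.NE2BalabanThreshold
import Summits.QuantumFields.BalabanUV.T4Continuum.Support.HodgeModelSlot

/-!
# T⁴ programme, spine node NE2 (U1a), tier B row B7 × row B2.w — THE HODGE-FORM VARIANT OF ROOT B (owner ruling R16 (iv): «B7 may offer the
# Hodge-form variant of the B2 slot as an ALTERNATIVE model»), and the c11 ⊇ c7 bridge: node NE3's `LocalRate` on the LARGER class `regClass₂`
# IMPLIES ROOT B's binder on `regClass`

NE2 formalisation swarm `b2b-balaban-t4-ne2-formalise-*`, leaf prover 08 (gen 2; row B7 of `t4/formal/NE2/LEAVES.md`), PART 2 file 9 (INTENT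
CLAIMS.log 2026-08-20 09:26Z).  Inputs BY NAME: `Spine/NE2BalabanFinal.perturbationLaws_balaban_final` (ROOT B's law on row data, leaf-08),
`Spine/NE2BalabanThreshold.{Kmax, etaStar, smallness_of_le, one_le_Kmax}` (leaf-08), `Spine/NE2BalabanLayerSharp.{kappaBs, KstarR, kappaBs_balaban_le_of_small}`
(leaf-03), `Support/HolonomyTowerRegular.{RegularSites, regClass₂, perturbationLaws_hodgeCorrection_of_regular_localRate, dconnTower_consistent,
RegularSites.toRegularTransporters}` (leaf-10-g2, row B2.w-feed), `Support/HodgeCorrectionLaws.hodgeCorr` (leaf-10-g2, row B2.w-laws),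
`Support/HodgeModelSlot.hodgePert` (leaf-10-g2; the Hodge-form B2 slot `covPertC + hodgeCorr`, EXACT `hodgePert_eq`), `Support/NE2FromNE3.{consistent_of_localRate_lev,
localRate_of_consistent}` (row B6), `Spine/NE2ColourPerturbedLayer.towerLimitRate_perturbed_king_kron` (PART 1).

WHAT THIS FILE DOES (MODEL LEVEL; the Hodge form is a VARIANT, NOT the instance of record — referee c11):
 * §1 **`localRate_regClass_of_regClass₂`**: `RegularSites Rb α β β₂ → LocalRate (bgReadings (regClass₂ Rb)) C L⁻¹ → LocalRate (bgReadings (regClass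
   (liftR Rb))) (betaNE3 o C + β₂) L⁻¹` — node NE3's shape on c11's LARGER class `{w} ∪ {D_lam w}` IMPLIES ROOT B's binder on row B5's class `{w, D_νw_ν}`,
   the constant shifted by the (3.36)-shape budget `β₂` (the `D_νw_ν = D_νw∘τ_ν⁻¹` member is DERIVED: `dconnTower_consistent`).  So a consumer holding the
   B2.w binders holds ROOT B's.
 * §2 **`perturbationLaws_balaban_hodge`**: the target shape for the HODGE-FORM TIER-B PERTURBATION
   `P_H k = balabanPert (liftR Rb) (gaugeSlot …) k + hodgeCorr Rb k` (= `hodgePert Rb + avgPert + gaugeSlot`, `balabanHodge_eq`: the B2 slot in the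
   lattice Weitzenböck∕Hodge form `lift(½curlᴴcurl + divᴴdiv) − Lap ⊗ 1` instead of the componentwise covariant Laplacian) — `perturbationLaws_add` of
   ROOT B's law (fed through §1) and row B2.w's `perturbationLaws_hodgeCorrection_of_regular_localRate`; binders DISPLAYED: `hreg₂ : RegularSites Rb α β β₂`
   ((3.35)+(3.36) shapes), `hNE3₂ : LocalRate (bgReadings (regClass₂ Rb)) C L⁻¹` (node NE3 on the larger class, OPEN), `0 < a′`, the B4 thresholds, and
   `hS` (the mixed-shift `ShiftLaws`, the owner's `shiftLaws_mixed` — v1.1 PENDING).  Constants `κ_H = κ_B + κ_w`, `C₂^H = C₂^B(C₁) + C_w`,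
   `C₁ = betaNE3 o C + β₂`, `κ_w = d²(2β + 2α²)Cst`.
 * §3 **`balaban_hodge_rate`** (every `‖t‖·κ_H < 1`) and **`balaban_hodge_rate_of_regular`** at `t = 1` under TWO explicit thresholds `η ≤ etaStar o d a a′`
   (⇒ `κ_B ≤ ½`) and `η ≤ 1/(8(d²Cst + 1))` (⇒ `κ_w ≤ 4d²Cst·η < ½`): `TowerLimitRate (Qlev ⊗ 1) L^d (k ↦ (Δ_a ⊗ 1 + P_H k)⁻¹) (Cpert κ_H (2dCst) CJ C₂^H 0 1) L⁻¹`.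

HONEST FRAMING (T4-DAG p. 1).  Composition BY NAME; `Rb`, `a′` DATA; hypothesis SHAPES; the Hodge form is an ALTERNATIVE MODEL of the B2 slot (no
identification of either form with Bałaban's Δ(U) of [B9] (3.10) is asserted — that is the dictionary B0, c5; the carver's c1 ruling decides which form,
if any, is wanted); `hS` and `hNE3₂` DISPLAYED (B2.w asks node NE3 for MORE than ROOT B, c11 — §1 makes the «more» precise); GLOBAL small field; finite
torus, linear layer, operator norm; NE2 (U1a) NOT PROVED; spine PROVED 0/9 unchanged; NOT infinite volume / mass gap / Clay.  HONEST DEPENDENCY: continuum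
YM on T⁴ ⇐ BetaPertH ∧ nine spine estimates (0/9 proved); BetaPertH ⇐ (D1) ∧ (D4) ∧ CAP+tail; G-an2-4 gates asym, D1 and NE2/3/4.  ABSOLUTE RULE kept; no
`def … : Prop` fact; no new definition; no `sorry`.
-/

noncomputable section

open scoped BigOperators ComplexConjugate Matrix Matrix.Norms.L2Operator Kronecker
open Filter Topology

namespace Summit.QuantumFields.BalabanUV.T4Continuum.NE2BalabanHodge

open Literature.MathematicalPhysics.QuantumFieldTheory.Balaban1983to89.B5Prop11Plancherel (Cst Cst_nonneg Tor fine shiftM)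
open Literature.MathematicalPhysics.QuantumFieldTheory.Balaban1983to89.B5G183RateUnitTower (lev lev_neZero)
open Literature.MathematicalPhysics.QuantumFieldTheory.Balaban1983to89.T4EtaRateMin (LocalRate)
open Summit.QuantumFields.BalabanUV.T4Continuum
open Summit.QuantumFields.BalabanUV.T4Continuum.CovariantAveragingTower (TowerLimitRate)
open Summit.QuantumFields.BalabanUV.T4Continuum.BalabanAveragedTowerUnit (idx Qlev)
open Summit.QuantumFields.BalabanUV.T4Continuum.BackgroundResolventTower
open Summit.QuantumFields.BalabanUV.T4Continuum.KingPairingPlantedLaw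
open Summit.QuantumFields.BalabanUV.T4Continuum.BlockPairingGeometry (parT)
open Summit.QuantumFields.BalabanUV.T4Continuum.GramPerturbationLaw (C2gram)
open Summit.QuantumFields.BalabanUV.T4Continuum.PerturbationAlgebra (perturbationLaws_add perturbationLaws_mono)
open Summit.QuantumFields.BalabanUV.T4Continuum.NE2FromNE3 (bgReadings consistent_of_localRate_lev localRate_of_consistent)
open Summit.QuantumFields.BalabanUV.T4Continuum.NE2ColourPerturbedLayer (towerLimitRate_perturbed_king_kron)
open Summit.QuantumFields.BalabanUV.T4Continuum.CovariantAveragingSummand (kappaQ kappaQ_ofReal)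
open Summit.QuantumFields.BalabanUV.T4Continuum.ColourCovariantLaplacian (covPertC)
open Summit.QuantumFields.BalabanUV.T4Continuum.RegularBackgroundTower (RegularTransporters connTower dconnTower regClass betaNE3)
open Summit.QuantumFields.BalabanUV.T4Continuum.ShiftedZerothOrder (ShiftLaws)
open Summit.QuantumFields.BalabanUV.T4Continuum.HodgeCorrectionLaws (hodgeCorr)
open Summit.QuantumFields.BalabanUV.T4Continuum.HolonomyTowerRegular
open Summit.QuantumFields.BalabanUV.T4Continuum.HodgeModelSlot (hodgePert)
open Summit.QuantumFields.BalabanUV.T4Continuum.GaugeTermPerturbationLaw (deltaK)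
open Summit.QuantumFields.BalabanUV.T4Continuum.GaugeTermScalarData (QuT Q1)
open Summit.QuantumFields.BalabanUV.T4Continuum.GaugeTermInstanceGeom (gS)
open Summit.QuantumFields.BalabanUV.T4Continuum.ScalarAveragedCompression (sigma0)
open Summit.QuantumFields.BalabanUV.T4Continuum.ScalarCovariantLaplacian (kappaS)
open Summit.QuantumFields.BalabanUV.T4Continuum.RegularSiteTransporters (siteT)
open Summit.QuantumFields.BalabanUV.T4Continuum.NestedContourTransport (theta0)
open Summit.QuantumFields.BalabanUV.T4Continuum.NE2BalabanLayer (tierBPert)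
open Summit.QuantumFields.BalabanUV.T4Continuum.NE2BalabanRoot (avgPert balabanPert)
open Summit.QuantumFields.BalabanUV.T4Continuum.NE2BalabanGauge (gaugeSlot liftR)
open Summit.QuantumFields.BalabanUV.T4Continuum.NE2BalabanLayerSharp (kappaBs C2Bs KstarR kappaBs_balaban_le_of_small)
open Summit.QuantumFields.BalabanUV.T4Continuum.NE2BalabanWiring (epsR CdeltaR epsR_nonneg)
open Summit.QuantumFields.BalabanUV.T4Continuum.NE2BalabanFinal (tauR kappa4F C4F perturbationLaws_balaban_final)
open Summit.QuantumFields.BalabanUV.T4Continuum.NE2BalabanThreshold (Kmax etaStar one_le_Kmax smallness_of_le)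

variable {d : ℕ} (L : ℕ) [NeZero L] (M : Fin d → ℕ) [hM : ∀ μ, NeZero (M μ)] (a : ℝ) (ha : 0 < a)
variable {o : Type*} [Fintype o] [DecidableEq o]
variable {Rb : (k : ℕ) → Fin d → Tor (fine (lev L k) M) → Matrix o o ℂ} {α β β₂ : ℝ}

/-! ## §1 The c11 ⊇ c7 bridge: NE3's shape on `regClass₂` implies ROOT B's binder on `regClass` -/

/-- **NODE NE3's `LocalRate` ON THE LARGER CLASS IMPLIES ROOT B's BINDER** (referee c11 vs c7, made precise): from the (3.35)+(3.36)-shape structure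
`RegularSites Rb α β β₂` and `LocalRate (bgReadings (regClass₂ Rb)) C L⁻¹` (the connection `w` and ALL forward quotients `D_lam w`, constant `C`), ROOT B's
hypothesis `LocalRate (bgReadings (regClass (liftR Rb))) (betaNE3 o C + β₂) L⁻¹` on `{w, D_νw_ν}` — the `w` member has op-norm consistency
`2·card o·C/L^k` (row B6's `consistent_of_localRate_lev`), the backward quotient `D_νw_ν = D_νw∘τ_ν⁻¹` has `(2·card o·C + β₂)/L^k` (leaf-10's
`dconnTower_consistent`), and row B6's `localRate_of_consistent` packs both. [folklore] -/
theorem localRate_regClass_of_regClass₂ (h : RegularSites L M Rb α β β₂) {C : ℝ} (hC : 0 ≤ C)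
    (hNE3 : LocalRate (bgReadings L M (regClass₂ L M Rb)) C ((L : ℝ)⁻¹)) :
    LocalRate (bgReadings L M (regClass L M (liftR L M Rb))) (betaNE3 o C + β₂) ((L : ℝ)⁻¹) := by
  have hβ₂ := h.nonneg.2.2
  have hw := consistent_of_localRate_lev L M hC hNE3 (wT_mem_regClass₂ : wT L M Rb ∈ regClass₂ L M Rb)
  have hD := fun lam => consistent_of_localRate_lev L M hC hNE3 (DqT_mem_regClass₂ lam : DqT L M Rb lam ∈ regClass₂ L M Rb)
  refine localRate_of_consistent L M fun W hW k ν x' => ?_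
  have hn : (0 : ℝ) ≤ ((lev L k : ℕ) : ℝ) := Nat.cast_nonneg _
  rcases hW with rfl | hW
  · calc ‖connTower L M (liftR L M Rb) (k + 1) ν x' - connTower L M (liftR L M Rb) k ν (parT (lev L k) L M x')‖
        = ‖wT L M Rb (k + 1) ν x' - wT L M Rb k ν (parT (lev L k) L M x')‖ := rfl
      _ ≤ (2 * (Fintype.card o : ℝ) * C) / (lev L k : ℕ) := hw k ν x'
      _ ≤ (betaNE3 o C + β₂) / (lev L k : ℕ) := by
          refine div_le_div_of_nonneg_right ?_ hn
          unfold betaNE3; linarith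
  · rw [Set.mem_singleton_iff] at hW
    subst hW
    exact dconnTower_consistent h (fun k lam ν i => hD lam k ν i) k ν x'

omit [NeZero L] hM in
/-- `0 ≤ betaNE3 o C + β₂`. [folklore] -/
theorem betaNE3_add_nonneg (h : RegularSites L M Rb α β β₂) {C : ℝ} (hC : 0 ≤ C) : 0 ≤ betaNE3 o C + β₂ := by
  have := h.nonneg.2.2; unfold betaNE3; positivity

/-! ## §2 The Hodge-form tier-B perturbation and its `PerturbationLaws` -/

/-- **THE HODGE-FORM TIER-B PERTURBATION IS `hodgePert + avgPert + gaugeSlot`**: adding row B2.w's Weitzenböck correction `hodgeCorr` to the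
perturbation of record replaces the componentwise B2 slot `covPertC` by leaf-10's Hodge-form slot `hodgePert = covPertC + hodgeCorr`
(`= lift(½curlᴴcurl + divᴴdiv) − Lap ⊗ 1`, `HodgeModelSlot.hodgePert_eq`). [folklore] -/
theorem balabanHodge_eq (P₄ : (k : ℕ) → Matrix (idx L M k × o) (idx L M k × o) ℂ) (k : ℕ) :
    balabanPert L M a (liftR L M Rb) P₄ k + hodgeCorr L M Rb k = hodgePert L M Rb k + avgPert L M a (liftR L M Rb) k + P₄ k := by
  rw [balabanPert, tierBPert, hodgePert]
  show covPertC L M (liftR L M Rb) k + avgPert L M a (liftR L M Rb) k + P₄ k + hodgeCorr L M Rb k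
    = covPertC L M (liftR L M Rb) k + hodgeCorr L M Rb k + avgPert L M a (liftR L M Rb) k + P₄ k
  abel

/-- **`PerturbationLaws` FOR THE HODGE-FORM TIER-B PERTURBATION** (`d ≥ 1`): binders DISPLAYED — `hreg₂ : RegularSites Rb α β β₂` ((3.35)+(3.36) shapes),
`hNE3₂ : LocalRate (bgReadings (regClass₂ Rb)) C L⁻¹` (node NE3 BY NAME on c11's class, OPEN), `0 < a′`, the B4 thresholds `kappaS … < 1`, `σ₀⁻²·δK < 1`,
and the mixed-shift `ShiftLaws` `hS` (the owner's `shiftLaws_mixed`) ⟹ the target shape for `k ↦ balabanPert (liftR Rb) (gaugeSlot …) k + hodgeCorr Rb k`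
with `κ_H = κ_B + d²(2β + 2α²)Cst`, `C₂^H = C₂^B(C₁) + C_w`, `C₁ = betaNE3 o C + β₂` — ROOT B's `perturbationLaws_balaban_final` (through §1 and
`RegularSites.toRegularTransporters`) `+` row B2.w's `perturbationLaws_hodgeCorrection_of_regular_localRate`.  A VARIANT model (c11); NE2 NOT proved by
this. [folklore] -/
theorem perturbationLaws_balaban_hodge (hd : 1 ≤ d) (h : RegularSites L M Rb α β β₂) {C : ℝ} (hC : 0 ≤ C)
    (hNE3 : LocalRate (bgReadings L M (regClass₂ L M Rb)) C ((L : ℝ)⁻¹)) {a' : ℝ} (ha' : 0 < a')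
    (hκ : kappaS d a' α β (tauR d α) < 1)
    (hsmall : ((sigma0 d a') ^ 2)⁻¹ * deltaK (gS d a' (kappaS d a' α β (tauR d α))) (1 + tauR d α) (d * α) (tauR d α) a' < 1)
    {cm : ℝ} (hS : ∀ μ ν, ShiftLaws L M a ha (fun k => ((shiftM (fine (lev L k) M) μ)ᴴ * shiftM (fine (lev L k) M) ν) ⊗ₖ (1 : Matrix o o ℂ)) cm) :
    PerturbationLaws (fun k => calDalev L M a ha k ⊗ₖ (1 : Matrix o o ℂ))
      (fun k => balabanPert L M a (liftR L M Rb) (gaugeSlot L M Rb (QuT L M o (siteT L M Rb)) (Q1 L M o) a') k + hodgeCorr L M Rb k)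
      (fun k => JpcT L M k ⊗ₖ (1 : Matrix o o ℂ))
      (kappaBs o d a α β (kappaQ d a (a : ℂ) (epsR o d α)) (kappa4F d a a' α β) + (d : ℝ) ^ 2 * ((2 * β + 2 * α ^ 2) * Cst d a))
      (fun k => C2Bs o d L a α β (betaNE3 o C + β₂)
          (a * C2gram (Cst d a) 1 (epsR o d α) (2 * d * Cst d a) (CJ d a) (Cst d a)
            (CdeltaR o d a α (theta0 d α (betaNE3 o (betaNE3 o C + β₂)))))
          (C4F o d L a a' α β (betaNE3 o C + β₂)) * ((L : ℝ)⁻¹) ^ k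
        + (d : ℝ) ^ 2 * (Cst d a * ((2 * β + 2 * α ^ 2) * cm
          + (2 * (betaNE3 o C + β₂) + 4 * α * (betaNE3 o C + β)) * Cst d a)) * ((L : ℝ)⁻¹) ^ k) :=
  perturbationLaws_add
    (perturbationLaws_balaban_final L M a ha hd h.toRegularTransporters (betaNE3_add_nonneg L M h hC)
      (localRate_regClass_of_regClass₂ L M h hC hNE3) ha' hκ hsmall)
    (perturbationLaws_hodgeCorrection_of_regular_localRate a ha h hC hNE3 hS)

/-! ## §3 The rate for the Hodge-form variant -/

/-- **THE η-RATE FOR THE HODGE-FORM VARIANT ON ITS NEUMANN DISC** (`L ≥ 2`, `d ≥ 1`): for every coupling with `‖t‖·κ_H < 1`,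
`TowerLimitRate (Qlev ⊗ 1) L^d (k ↦ (Δ_a^{(k)} ⊗ 1 + t·P_H k)⁻¹) (Cpert κ_H (2dCst) CJ C₂^H 0 t) L⁻¹` — PART 1's `towerLimitRate_perturbed_king_kron`.
Binders as in `perturbationLaws_balaban_hodge`, all displayed; a VARIANT (c11); NE2 NOT proved by this. [folklore] -/
theorem balaban_hodge_rate (hL : 2 ≤ L) (hd : 1 ≤ d) (h : RegularSites L M Rb α β β₂) {C : ℝ} (hC : 0 ≤ C)
    (hNE3 : LocalRate (bgReadings L M (regClass₂ L M Rb)) C ((L : ℝ)⁻¹)) {a' : ℝ} (ha' : 0 < a')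
    (hκ : kappaS d a' α β (tauR d α) < 1)
    (hsmall : ((sigma0 d a') ^ 2)⁻¹ * deltaK (gS d a' (kappaS d a' α β (tauR d α))) (1 + tauR d α) (d * α) (tauR d α) a' < 1)
    {cm : ℝ} (hS : ∀ μ ν, ShiftLaws L M a ha (fun k => ((shiftM (fine (lev L k) M) μ)ᴴ * shiftM (fine (lev L k) M) ν) ⊗ₖ (1 : Matrix o o ℂ)) cm)
    {t : ℂ} (ht : ‖t‖ * (kappaBs o d a α β (a * (epsR o d α * (2 + epsR o d α) * Cst d a)) (kappa4F d a a' α β)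
      + (d : ℝ) ^ 2 * ((2 * β + 2 * α ^ 2) * Cst d a)) < 1) :
    TowerLimitRate (fun k => Qlev L M k ⊗ₖ (1 : Matrix o o ℂ)) ((L : ℝ) ^ d)
      (fun k => (calDalev L M a ha k ⊗ₖ (1 : Matrix o o ℂ)
        + t • (balabanPert L M a (liftR L M Rb) (gaugeSlot L M Rb (QuT L M o (siteT L M Rb)) (Q1 L M o) a') k + hodgeCorr L M Rb k))⁻¹)
      (Cpert (kappaBs o d a α β (a * (epsR o d α * (2 + epsR o d α) * Cst d a)) (kappa4F d a a' α β)
          + (d : ℝ) ^ 2 * ((2 * β + 2 * α ^ 2) * Cst d a)) (2 * d * Cst d a) (CJ d a)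
        (C2Bs o d L a α β (betaNE3 o C + β₂)
            (a * C2gram (Cst d a) 1 (epsR o d α) (2 * d * Cst d a) (CJ d a) (Cst d a)
              (CdeltaR o d a α (theta0 d α (betaNE3 o (betaNE3 o C + β₂)))))
            (C4F o d L a a' α β (betaNE3 o C + β₂))
          + (d : ℝ) ^ 2 * (Cst d a * ((2 * β + 2 * α ^ 2) * cm + (2 * (betaNE3 o C + β₂) + 4 * α * (betaNE3 o C + β)) * Cst d a)))
        0 t) ((L : ℝ)⁻¹) := by
  have hlaw := perturbationLaws_balaban_hodge L M a ha hd h hC hNE3 ha' hκ hsmall hS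
  rw [kappaQ_ofReal ha.le] at hlaw
  exact towerLimitRate_perturbed_king_kron L M a ha hL (perturbationLaws_mono hlaw le_rfl fun k => le_of_eq (by ring)) ht

omit [NeZero L] hM [DecidableEq o] in
/-- **THE TWO EXPLICIT THRESHOLDS PUT `t = 1` IN THE NEUMANN DISC OF THE VARIANT**: `α, β ≤ η ≤ etaStar o d a a′` gives `κ_B ≤ ½` (the second half
of `η⋆`), and `η ≤ 1/(8(d²·Cst + 1))` gives `κ_w = d²(2β + 2α²)Cst ≤ 4d²Cst·η < ½`. [folklore] -/
theorem kappaHodge_lt_one (ha0 : 0 ≤ a) {a' α β η : ℝ} (ha' : 0 < a') (hα : 0 ≤ α) (hβ : 0 ≤ β) (hαη : α ≤ η) (hβη : β ≤ η)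
    (hη : η ≤ etaStar o d a a') (hηH : η ≤ 1 / (8 * ((d : ℝ) ^ 2 * Cst d a + 1))) :
    ‖(1 : ℂ)‖ * (kappaBs o d a α β (a * (epsR o d α * (2 + epsR o d α) * Cst d a)) (kappa4F d a a' α β)
      + (d : ℝ) ^ 2 * ((2 * β + 2 * α ^ 2) * Cst d a)) < 1 := by
  rw [norm_one, one_mul]
  obtain ⟨-, -, h3, h4, h5, h6, h7, -⟩ := smallness_of_le (o := o) (d := d) a ha0 ha' hα hβ hαη hβη hη
  have hKmax := one_le_Kmax (o := o) (d := d) (a := a) ha'.le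
  have hKs : 0 ≤ KstarR o d a := NE2BalabanThreshold.KstarR_nonneg (o := o) (d := d) a ha0
  have hCst := Cst_nonneg d a
  have hd0 : (0 : ℝ) ≤ (d : ℝ) ^ 2 := sq_nonneg _
  have hη0 : 0 ≤ η := hα.trans hαη
  -- `κ_B ≤ η·Kmax·KstarR ≤ ½`
  have hκB := kappaBs_balaban_le_of_small (o := o) (d := d) a ha0 hα (epsR_nonneg (o := o) (d := d) hα) h3 h4 h5 h6 h7
  have hB : η * (2 * Kmax o d a a' * (KstarR o d a + 1)) ≤ 1 := by
    have h := hη.trans (min_le_right _ _)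
    have hpos : 0 < 2 * Kmax o d a a' * (KstarR o d a + 1) := by positivity
    rwa [le_div_iff₀ hpos] at h
  have hhalfB : η * Kmax o d a a' * KstarR o d a ≤ 1 / 2 := by nlinarith
  -- `κ_w ≤ 4d²Cst·η < ½`
  have hη1 : η ≤ 1 := by nlinarith
  have hsq : α ^ 2 ≤ η := by nlinarith
  have hw : (d : ℝ) ^ 2 * ((2 * β + 2 * α ^ 2) * Cst d a) ≤ 4 * ((d : ℝ) ^ 2 * Cst d a) * η := by nlinarith [mul_nonneg hd0 hCst]
  have hW : 4 * ((d : ℝ) ^ 2 * Cst d a) * η < 1 / 2 := by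
    have hpos : 0 < 8 * ((d : ℝ) ^ 2 * Cst d a + 1) := by positivity
    have h := (le_div_iff₀ hpos).mp hηH
    nlinarith [mul_nonneg hd0 hCst]
  linarith

/-- **THE HODGE-FORM VARIANT OF ROOT B AT `t = 1` UNDER TWO EXPLICIT THRESHOLDS** (`L ≥ 2`, `d ≥ 1`, `a′ > 0`): displayed binders `hreg₂ : RegularSites
Rb α β β₂`, `hNE3₂ : LocalRate (bgReadings (regClass₂ Rb)) C L⁻¹` (node NE3, OPEN), `hS` (mixed-shift `ShiftLaws`), `α ≤ η`, `β ≤ η`, `η ≤ etaStar o d a a′`,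
`η ≤ 1/(8(d²Cst + 1))` ⟹ the lifted King-averaged unit-lattice covariances of `(Δ_a^{(k)} ⊗ 1 + P_H k)⁻¹`, `P_H = hodgePert + avgPert + gaugeSlot`
(`balabanHodge_eq`), CONVERGE with rate `L^{−k}`.  A VARIANT of the B2 slot (c11), off the instance of record; NE2 (U1a) NOT proved by this. [folklore] -/
theorem balaban_hodge_rate_of_regular (hL : 2 ≤ L) (hd : 1 ≤ d) (h : RegularSites L M Rb α β β₂) {C : ℝ} (hC : 0 ≤ C)
    (hNE3 : LocalRate (bgReadings L M (regClass₂ L M Rb)) C ((L : ℝ)⁻¹)) {a' : ℝ} (ha' : 0 < a')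
    {cm : ℝ} (hS : ∀ μ ν, ShiftLaws L M a ha (fun k => ((shiftM (fine (lev L k) M) μ)ᴴ * shiftM (fine (lev L k) M) ν) ⊗ₖ (1 : Matrix o o ℂ)) cm)
    {η : ℝ} (hαη : α ≤ η) (hβη : β ≤ η) (hη : η ≤ etaStar o d a a') (hηH : η ≤ 1 / (8 * ((d : ℝ) ^ 2 * Cst d a + 1))) :
    TowerLimitRate (fun k => Qlev L M k ⊗ₖ (1 : Matrix o o ℂ)) ((L : ℝ) ^ d)
      (fun k => (calDalev L M a ha k ⊗ₖ (1 : Matrix o o ℂ)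
        + (1 : ℂ) • (balabanPert L M a (liftR L M Rb) (gaugeSlot L M Rb (QuT L M o (siteT L M Rb)) (Q1 L M o) a') k + hodgeCorr L M Rb k))⁻¹)
      (Cpert (kappaBs o d a α β (a * (epsR o d α * (2 + epsR o d α) * Cst d a)) (kappa4F d a a' α β)
          + (d : ℝ) ^ 2 * ((2 * β + 2 * α ^ 2) * Cst d a)) (2 * d * Cst d a) (CJ d a)
        (C2Bs o d L a α β (betaNE3 o C + β₂)
            (a * C2gram (Cst d a) 1 (epsR o d α) (2 * d * Cst d a) (CJ d a) (Cst d a)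
              (CdeltaR o d a α (theta0 d α (betaNE3 o (betaNE3 o C + β₂)))))
            (C4F o d L a a' α β (betaNE3 o C + β₂))
          + (d : ℝ) ^ 2 * (Cst d a * ((2 * β + 2 * α ^ 2) * cm + (2 * (betaNE3 o C + β₂) + 4 * α * (betaNE3 o C + β)) * Cst d a)))
        0 1) ((L : ℝ)⁻¹) := by
  have hα := h.nonneg.1
  have hβ := h.nonneg.2.1
  obtain ⟨h1, h2, -, -, -, -, -, -⟩ := smallness_of_le (o := o) (d := d) a ha.le ha' hα hβ hαη hβη hη
  exact balaban_hodge_rate L M a ha hL hd h hC hNE3 ha' h1 h2 hS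
    (kappaHodge_lt_one (o := o) (d := d) a ha.le ha' hα hβ hαη hβη hη hηH)

end Summit.QuantumFields.BalabanUV.T4Continuum.NE2BalabanHodge

end
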